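import Literature.AlgebraicGeometry.Tropical.TropicalTorusWeilCycles
import Summits.HodgeConjecture.HodgeConjecture.Theorems.TropicalKugaSatakeCayleyFormalCycleCriterionIsCycleOfIncidences
import HarnessLib

/-!
# Crux `FormalCycleCriterion` (stmt-HodgeConjecture-18571), line `birth` — lemmas towards stub 3
# `stub_cycleClassRational` (period classes of tropical cycles are rational)

Route `TropicalKugaSatakeCayley` of `HodgeConjecture`. Three self-contained lemmas used by the
proof of the registered stub `stub_cycleClassRational` (file
`TropicalKugaSatakeCayleyFormalCycleCriterionCycleClassRational`):

* `sum_minor_mul_pluecker` — the Cauchy–Binet formula for `2 × 2` minors: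
  `Σ_I minor A K I · pluecker D I = pluecker (A · D) K` for `A : g × g`, `D : g × 2`, `K, I` running
  over the `2`-subsets of `Fin g` (i.e. `⋀²A (D₀ ∧ D₁) = A D₀ ∧ A D₁` in the basis `e_K`).
* `exists_rep_intPart` — a choice of representatives of `ℝ^g` modulo `ℤ^g`: functions
  `rep : ℝ^g → ℝ^g` and `ℓ : ℝ^g → ℤ^g` with `v = rep v + ℓ v`, `rep (v + k) = rep v` and
  `ℓ (v + k) = ℓ v + k` for `k ∈ ℤ^g`.
* `sum_bilin_eq_sum_bilin_intPart` — the DISCRETE STOKES identity behind the rationality of period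
  classes, in abstract form: for a finite family of ordered pairs `(x_t, y_t)` of points of `ℝ^g`
  with real weights `μ_t`, closed under an involution exchanging `x` and `y` and negating `μ`,
  whose `ℤ^g`-translation classes have zero total weight (the cycle condition) and whose weights
  cancel around every start point (`Σ_t μ_t F(x_t) = 0` for every `F`), and for every antisymmetric
  bilinear form `B`: `Σ_t μ_t B(x_t, y_t) = Σ_t μ_t B(ℓ x_t, ℓ y_t)` — the weighted sum of `B` over the
  pairs is unchanged when every point is replaced by its integer part.

## References

* [Zharkov2020TropicalWeil] I. Zharkov, Tropical abelian varieties, Weil classes and the Hodge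
  conjecture, arXiv:2002.02347 (2020), p. 2.
* [MikhalkinZharkov2014Eigenwave] G. Mikhalkin, I. Zharkov, Tropical eigenwave and intermediate
  Jacobians, LN UMI 15 (2014), Prop. 4.3, Thm. 5.4.
-/

noncomputable section

-- `Summit.HodgeConjecture.HodgeConjecture.…` is the mandated namespace (single-conjunct summit).
set_option linter.dupNamespace false

open scoped BigOperators

namespace Summit.HodgeConjecture.HodgeConjecture.Theorems.FormalCycleCriterion

open Literature.AlgebraicGeometry.Tropical
open Literature.AlgebraicGeometry.Tropical.TropicalTorus

/-! ### Cauchy–Binet for `2 × 2` minors -/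

section CauchyBinet

variable {S : Type*} [CommRing S] {g : ℕ}

/-- The increasing enumeration of a pair `{a < b} ⊆ Fin g` is `(a, b)`. [folklore] -/
theorem orderEmbOfFin_pair {a b : Fin g} (hab : a < b) (h : ({a, b} : Finset (Fin g)).card = 2) :
    (Finset.orderEmbOfFin {a, b} h 0 : Fin g) = a ∧ (Finset.orderEmbOfFin {a, b} h 1 : Fin g) = b := by
  have hm0 : Finset.orderEmbOfFin {a, b} h 0 ∈ ({a, b} : Finset (Fin g)) :=
    Finset.orderEmbOfFin_mem _ _ 0
  have hm1 : Finset.orderEmbOfFin {a, b} h 1 ∈ ({a, b} : Finset (Fin g)) :=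
    Finset.orderEmbOfFin_mem _ _ 1
  have hlt : Finset.orderEmbOfFin {a, b} h 0 < Finset.orderEmbOfFin {a, b} h 1 :=
    (Finset.orderEmbOfFin _ h).strictMono (by decide)
  simp only [Finset.mem_insert, Finset.mem_singleton] at hm0 hm1
  rcases hm0 with h0 | h0 <;> rcases hm1 with h1 | h1 <;> rw [h0, h1] at hlt
  · exact absurd hlt (lt_irrefl _)
  · exact ⟨h0, h1⟩
  · exact absurd (hlt.trans hab) (lt_irrefl _)
  · exact absurd hlt (lt_irrefl _)

/-- The two elements `k₀ < k₁` of a `2`-subset enumerate it. [folklore] -/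
theorem pair_orderEmbOfFin_eq (K : Sub g 2) :
    ({K.1.orderEmbOfFin K.2 0, K.1.orderEmbOfFin K.2 1} : Finset (Fin g)) = K.1 := by
  ext x
  constructor
  · intro hx
    simp only [Finset.mem_insert, Finset.mem_singleton] at hx
    rcases hx with rfl | rfl <;> exact Finset.orderEmbOfFin_mem _ _ _
  · intro hx
    have hx' : x ∈ Set.range (K.1.orderEmbOfFin K.2) := by
      rw [Finset.range_orderEmbOfFin]; exact hx
    obtain ⟨i, rfl⟩ := hx'
    simp only [Finset.mem_insert, Finset.mem_singleton]
    rcases Fin.exists_fin_two.mp ⟨i, rfl⟩ with hi | hi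
    · exact Or.inl (by rw [hi])
    · exact Or.inr (by rw [hi])

/-- A `2 × 2` minor, expanded. [folklore] -/
theorem minor_two (A : Matrix (Fin g) (Fin g) S) (K I : Sub g 2) :
    minor A K I = A (K.1.orderEmbOfFin K.2 0) (I.1.orderEmbOfFin I.2 0) *
        A (K.1.orderEmbOfFin K.2 1) (I.1.orderEmbOfFin I.2 1) -
      A (K.1.orderEmbOfFin K.2 0) (I.1.orderEmbOfFin I.2 1) *
        A (K.1.orderEmbOfFin K.2 1) (I.1.orderEmbOfFin I.2 0) := by
  unfold minor
  rw [Matrix.det_fin_two]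
  simp only [Matrix.submatrix_apply]

/-- A Plücker coordinate of a `g × 2` frame, expanded. [folklore] -/
theorem pluecker_two (D : Matrix (Fin g) (Fin 2) S) (I : Sub g 2) :
    pluecker D I = D (I.1.orderEmbOfFin I.2 0) 0 * D (I.1.orderEmbOfFin I.2 1) 1 -
      D (I.1.orderEmbOfFin I.2 0) 1 * D (I.1.orderEmbOfFin I.2 1) 0 := by
  unfold pluecker
  rw [Matrix.det_fin_two]
  simp only [Matrix.submatrix_apply, id]

/-- Reindexing a sum over the `2`-subsets of `Fin g` as a sum over the ordered pairs `a < b`.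
[folklore] -/
theorem sum_sub_two_eq_sum_lt {M : Type*} [AddCommMonoid M] (F : Fin g → Fin g → M) :
    ∑ I : Sub g 2, F (I.1.orderEmbOfFin I.2 0) (I.1.orderEmbOfFin I.2 1) =
      ∑ ab ∈ (Finset.univ ×ˢ Finset.univ).filter (fun ab : Fin g × Fin g => ab.1 < ab.2),
        F ab.1 ab.2 := by
  refine Finset.sum_bij (fun I _ => (I.1.orderEmbOfFin I.2 0, I.1.orderEmbOfFin I.2 1))
    ?_ ?_ ?_ ?_
  · intro I _
    simp only [Finset.mem_filter, Finset.mem_product, Finset.mem_univ, true_and]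
    exact (Finset.orderEmbOfFin _ I.2).strictMono (by decide)
  · intro I _ J _ h
    simp only [Prod.mk.injEq] at h
    apply Subtype.ext
    rw [← pair_orderEmbOfFin_eq I, ← pair_orderEmbOfFin_eq J, h.1, h.2]
  · intro ab hab
    simp only [Finset.mem_filter, Finset.mem_product, Finset.mem_univ, true_and] at hab
    refine ⟨⟨{ab.1, ab.2}, Finset.card_pair hab.ne⟩, Finset.mem_univ _, ?_⟩
    obtain ⟨h0, h1⟩ := orderEmbOfFin_pair hab (Finset.card_pair hab.ne)
    exact Prod.ext h0 h1
  · intro I _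
    rfl

/-- Splitting a double sum of an "alternating" summand over ordered pairs into the pairs `a < b`:
if `G a a = 0` then `Σ_{a,b} G a b = Σ_{a<b} (G a b + G b a)`. [folklore] -/
theorem sum_sum_eq_sum_lt_add {M : Type*} [AddCommMonoid M] (G : Fin g → Fin g → M)
    (hdiag : ∀ a, G a a = 0) :
    ∑ a, ∑ b, G a b =
      ∑ ab ∈ (Finset.univ ×ˢ Finset.univ).filter (fun ab : Fin g × Fin g => ab.1 < ab.2),
        (G ab.1 ab.2 + G ab.2 ab.1) := by
  rw [← Finset.sum_product (s := Finset.univ) (t := Finset.univ) (f := fun ab => G ab.1 ab.2)]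
  rw [Finset.sum_add_distrib]
  rw [← Finset.sum_filter_add_sum_filter_not (Finset.univ ×ˢ Finset.univ)
    (fun ab : Fin g × Fin g => ab.1 < ab.2)]
  congr 1
  -- the pairs with `¬ a < b` are the diagonal (zero contribution) and the pairs `b < a`
  rw [← Finset.sum_filter_add_sum_filter_not
    ((Finset.univ ×ˢ Finset.univ).filter (fun ab : Fin g × Fin g => ¬ ab.1 < ab.2))
    (fun ab : Fin g × Fin g => ab.2 < ab.1)]
  have hzero : ∑ ab ∈ ((Finset.univ ×ˢ Finset.univ).filter
      (fun ab : Fin g × Fin g => ¬ ab.1 < ab.2)).filter (fun ab : Fin g × Fin g => ¬ ab.2 < ab.1),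
      G ab.1 ab.2 = 0 := by
    refine Finset.sum_eq_zero fun ab hab => ?_
    simp only [Finset.mem_filter, Finset.mem_product, Finset.mem_univ, true_and] at hab
    have : ab.1 = ab.2 := le_antisymm (not_lt.1 hab.2) (not_lt.1 hab.1)
    rw [this, hdiag]
  rw [hzero, add_zero]
  -- flip the pairs `b < a`
  refine Finset.sum_nbij' Prod.swap Prod.swap ?_ ?_ ?_ ?_ ?_
  · intro ab hab
    simp only [Finset.mem_filter, Finset.mem_product, Finset.mem_univ, true_and] at hab ⊢
    exact hab.2
  · intro ab hab
    simp only [Finset.mem_filter, Finset.mem_product, Finset.mem_univ, true_and] at hab ⊢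
    exact ⟨not_lt.2 hab.le, hab⟩
  · intro ab _; rfl
  · intro ab _; rfl
  · intro ab _; rfl

/-- The `2 × 2` "wedge" of two linear combinations: `(p·x)(q·y) − (p·y)(q·x) =
Σ_{a,b} (p_a q_b − p_b q_a) x_a y_b`. [folklore] -/
theorem sum_mul_sum_sub_sum_mul_sum (p q x y : Fin g → S) :
    (∑ a, p a * x a) * (∑ b, q b * y b) - (∑ a, p a * y a) * (∑ b, q b * x b) =
      ∑ a, ∑ b, (p a * q b - p b * q a) * (x a * y b) := by
  rw [Finset.sum_mul_sum, Finset.sum_mul_sum,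
    Finset.sum_comm (f := fun a b => p a * y a * (q b * x b)), ← Finset.sum_sub_distrib]
  refine Finset.sum_congr rfl fun a _ => ?_
  rw [← Finset.sum_sub_distrib]
  refine Finset.sum_congr rfl fun b _ => ?_
  ring

/-- **Cauchy–Binet for `2 × 2` minors**: `Σ_I minor A K I · pluecker D I = pluecker (A · D) K`, i.e.
`⋀² A (D₀ ∧ D₁) = A D₀ ∧ A D₁` in the basis `e_K` of `⋀² S^g`. [folklore] -/
theorem sum_minor_mul_pluecker (A : Matrix (Fin g) (Fin g) S) (D : Matrix (Fin g) (Fin 2) S)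
    (K : Sub g 2) : ∑ I : Sub g 2, minor A K I * pluecker D I = pluecker (A * D) K := by
  -- the summand as a function `F` of the pair `(i₀, i₁)` enumerating `I`; `c(a,b)` its first factor
  let c : Fin g → Fin g → S := fun a b =>
    A (K.1.orderEmbOfFin K.2 0) a * A (K.1.orderEmbOfFin K.2 1) b -
      A (K.1.orderEmbOfFin K.2 0) b * A (K.1.orderEmbOfFin K.2 1) a
  let F : Fin g → Fin g → S := fun a b => c a b * (D a 0 * D b 1 - D a 1 * D b 0)
  have hL : ∑ I : Sub g 2, minor A K I * pluecker D I =
      ∑ ab ∈ (Finset.univ ×ˢ Finset.univ).filter (fun ab : Fin g × Fin g => ab.1 < ab.2),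
        F ab.1 ab.2 := by
    refine Eq.trans ?_ (sum_sub_two_eq_sum_lt F)
    refine Finset.sum_congr rfl fun I _ => ?_
    rw [minor_two, pluecker_two]
  -- the right-hand side as a double sum of `c(a,b) · D a 0 · D b 1`, `c` antisymmetric
  have hR : pluecker (A * D) K = ∑ a, ∑ b, c a b * (D a 0 * D b 1) := by
    rw [pluecker_two]
    simp only [Matrix.mul_apply]
    exact sum_mul_sum_sub_sum_mul_sum _ _ _ _
  rw [hL, hR, sum_sum_eq_sum_lt_add _ (fun a => by simp [c])]
  refine Finset.sum_congr rfl fun ab _ => ?_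
  simp only [F, c]
  ring

end CauchyBinet

/-! ### Representatives modulo `ℤ^g` and integer parts -/

/-- **Representatives of `ℝ^g / ℤ^g` and integer parts.** There are functions `rep : ℝ^g → ℝ^g`
and `ℓ : ℝ^g → ℤ^g` with `v = rep v + ℓ v`, `rep` constant on `ℤ^g`-cosets and `ℓ` translation
equivariant (`Quotient.out` on the coset space). [folklore] -/
theorem exists_rep_intPart (g : ℕ) :
    ∃ (rep : (Fin g → ℝ) → (Fin g → ℝ)) (ℓ : (Fin g → ℝ) → (Fin g → ℤ)),
      (∀ v, rep v + (fun r => (ℓ v r : ℝ)) = v) ∧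
      (∀ (v : Fin g → ℝ) (k : Fin g → ℤ), rep (v + fun r => (k r : ℝ)) = rep v) ∧
      (∀ (v : Fin g → ℝ) (k : Fin g → ℤ), ℓ (v + fun r => (k r : ℝ)) = ℓ v + k) := by
  let s : Setoid (Fin g → ℝ) :=
    { r := fun a b => ∃ k : Fin g → ℤ, b = a + fun r => (k r : ℝ)
      iseqv :=
        ⟨fun a => ⟨0, by funext r; simp⟩,
         fun {a b} h => by
           obtain ⟨k, hk⟩ := h
           exact ⟨-k, by rw [hk]; funext r; simp⟩,
         fun {a b c} h h' => by
           obtain ⟨k, hk⟩ := h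
           obtain ⟨k', hk'⟩ := h'
           exact ⟨k + k', by rw [hk', hk]; funext r; simp [add_assoc]⟩⟩ }
  let rep : (Fin g → ℝ) → (Fin g → ℝ) := fun v => (Quotient.mk s v).out
  have hrep : ∀ v, ∃ k : Fin g → ℤ, v = rep v + fun r => (k r : ℝ) :=
    fun v => Quotient.mk_out (s := s) v
  choose ℓ hℓ using hrep
  have hconst : ∀ (v : Fin g → ℝ) (k : Fin g → ℤ), rep (v + fun r => (k r : ℝ)) = rep v := by
    intro v k
    show (Quotient.mk s _).out = (Quotient.mk s v).out
    congr 1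
    exact Quotient.sound ⟨-k, by funext r; simp⟩
  refine ⟨rep, ℓ, fun v => (hℓ v).symm, hconst, fun v k => ?_⟩
  have h1 := hℓ (v + fun r => (k r : ℝ))
  rw [hconst] at h1
  have h2 := hℓ v
  funext r
  have e1 := congr_fun h1 r
  have e2 := congr_fun h2 r
  simp only [Pi.add_apply] at e1 e2
  have : ((ℓ (v + fun r => (k r : ℝ)) r : ℤ) : ℝ) = (ℓ v r : ℝ) + (k r : ℝ) := by linarith
  exact_mod_cast this

/-! ### The discrete Stokes identity -/

open Classical in
/-- **Discrete Stokes identity** (abstract form). A finite family of ordered pairs `(x_t, y_t)` of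
points of `ℝ^g` with real weights `μ_t`, an involution `bar` exchanging `x` and `y` and negating
`μ`, every `ℤ^g`-translation class of pairs of zero total weight (`hcyc`, the cycle condition), and
the weights cancelling around each start point against every test function (`hstart`). Then for
every antisymmetric bilinear form `B` and every decomposition `v = rep v + ℓ v` with `rep`
constant on `ℤ^g`-cosets, `Σ_t μ_t B(x_t, y_t) = Σ_t μ_t B(ℓ x_t, ℓ y_t)`. Proof: expand
`B(rep x + ℓ x, rep y + ℓ y)`; the `B(rep x, rep y)` terms are constant on classes and die by
`hcyc`; the two mixed terms are equal (involution) and `B(rep x, ℓ y) = B(rep x, y − x) + B(rep x, x)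
− B(rep x, rep y)` dies term by term (`hcyc` for the class-constant `y − x`, `hstart`, `hcyc`).
[folklore] -/
theorem sum_bilin_eq_sum_bilin_intPart {g : ℕ} {T : Type*} [Fintype T] [DecidableEq T]
    (x y : T → (Fin g → ℝ)) (μ : T → ℝ) (B : LinearMap.BilinForm ℝ (Fin g → ℝ))
    (hB : ∀ a b, B a b = -B b a) (bar : T ≃ T) (hbx : ∀ t, x (bar t) = y t)
    (hby : ∀ t, y (bar t) = x t) (hbμ : ∀ t, μ (bar t) = -μ t)
    (hcyc : ∀ t₀, ∑ t ∈ Finset.univ.filter (fun t => ∃ k : Fin g → ℤ,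
        x t = x t₀ + (fun r => (k r : ℝ)) ∧ y t = y t₀ + (fun r => (k r : ℝ))), μ t = 0)
    (hstart : ∀ F : (Fin g → ℝ) → ℝ, ∑ t, μ t * F (x t) = 0)
    (rep ℓ : (Fin g → ℝ) → (Fin g → ℝ)) (hdec : ∀ v, rep v + ℓ v = v)
    (hrep : ∀ (v : Fin g → ℝ) (k : Fin g → ℤ), rep (v + fun r => (k r : ℝ)) = rep v) :
    ∑ t, μ t * B (x t) (y t) = ∑ t, μ t * B (ℓ (x t)) (ℓ (y t)) := by
  classical
  -- the translation relation on indices: an equivalence relation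
  let R : T → T → Prop := fun t₀ t => ∃ k : Fin g → ℤ,
    x t = x t₀ + (fun r => (k r : ℝ)) ∧ y t = y t₀ + (fun r => (k r : ℝ))
  have hRrefl : ∀ t, R t t := fun t => ⟨0, by funext r; simp, by funext r; simp⟩
  have hRsymm : ∀ {a b}, R a b → R b a := by
    intro a b h
    obtain ⟨k, hx, hy⟩ := h
    refine ⟨-k, ?_, ?_⟩
    · rw [hx]; funext r; simp
    · rw [hy]; funext r; simp
  have hRtrans : ∀ {a b c}, R a b → R b c → R a c := by
    intro a b c h h'
    obtain ⟨k, hx, hy⟩ := h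
    obtain ⟨k', hx', hy'⟩ := h'
    refine ⟨k + k', ?_, ?_⟩
    · rw [hx', hx]; funext r; simp [add_assoc]
    · rw [hy', hy]; funext r; simp [add_assoc]
  -- class invariants: `rep x`, `rep y` and `y - x`
  have hinv : ∀ {a b}, R a b →
      rep (x b) = rep (x a) ∧ rep (y b) = rep (y a) ∧ y b - x b = y a - x a := by
    intro a b h
    obtain ⟨k, hx, hy⟩ := h
    exact ⟨by rw [hx, hrep], by rw [hy, hrep], by rw [hx, hy]; abel⟩
  -- (a) `μ` sums to zero against every class-invariant function
  have hzero : ∀ φ : T → ℝ, (∀ a b, R a b → φ b = φ a) → ∑ t, μ t * φ t = 0 := by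
    intro φ hφ
    refine sum_eq_zero_of_saturated R hRsymm hRtrans (fun t => μ t * φ t) ?_ Finset.univ
      (fun t _ => hRrefl t) (fun t _ t' _ => Finset.mem_univ _)
    intro t₀
    have : ∑ t ∈ Finset.univ.filter (R t₀), μ t * φ t =
        (∑ t ∈ Finset.univ.filter (R t₀), μ t) * φ t₀ := by
      rw [Finset.sum_mul]
      refine Finset.sum_congr rfl fun t ht => ?_
      rw [hφ t₀ t (Finset.mem_filter.1 ht).2]
    rw [this, hcyc t₀, zero_mul]
  -- the three vanishing sums
  have hE1 : ∑ t, μ t * B (rep (x t)) (rep (y t)) = 0 :=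
    hzero _ fun a b h => by rw [(hinv h).1, (hinv h).2.1]
  have hE2 : ∑ t, μ t * B (rep (x t)) (ℓ (y t)) = 0 := by
    have hpt : ∀ t, μ t * B (rep (x t)) (ℓ (y t)) =
        μ t * B (rep (x t)) (y t - x t) + μ t * B (rep (x t)) (x t) -
          μ t * B (rep (x t)) (rep (y t)) := by
      intro t
      have e : ℓ (y t) = (y t - x t) + x t - rep (y t) := by
        have := hdec (y t)
        rw [← sub_eq_iff_eq_add'.2 this.symm]
        abel
      rw [e, map_sub, map_add]
      ring
    simp_rw [hpt]
    rw [Finset.sum_sub_distrib, Finset.sum_add_distrib, hE1, hstart (fun v => B (rep v) v),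
      hzero _ fun a b h => by rw [(hinv h).1, (hinv h).2.2]]
    ring
  have hE3 : ∑ t, μ t * B (ℓ (x t)) (rep (y t)) = ∑ t, μ t * B (rep (x t)) (ℓ (y t)) := by
    calc ∑ t, μ t * B (ℓ (x t)) (rep (y t))
        = ∑ t, μ (bar t) * B (ℓ (x (bar t))) (rep (y (bar t))) :=
          (Equiv.sum_comp bar (fun t => μ t * B (ℓ (x t)) (rep (y t)))).symm
      _ = ∑ t, μ t * B (rep (x t)) (ℓ (y t)) :=
          Finset.sum_congr rfl fun t _ => by rw [hbx, hby, hbμ, hB (ℓ (y t))]; ring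
  -- pointwise expansion and assembly
  have hpt : ∀ t, μ t * B (x t) (y t) - μ t * B (ℓ (x t)) (ℓ (y t)) =
      μ t * B (rep (x t)) (rep (y t)) + μ t * B (rep (x t)) (ℓ (y t)) +
        μ t * B (ℓ (x t)) (rep (y t)) := by
    intro t
    have e : B (x t) (y t) = B (rep (x t) + ℓ (x t)) (rep (y t) + ℓ (y t)) := by rw [hdec, hdec]
    rw [e, map_add, map_add, LinearMap.add_apply, LinearMap.add_apply]
    ring
  rw [← sub_eq_zero, ← Finset.sum_sub_distrib]
  simp_rw [hpt]
  rw [Finset.sum_add_distrib, Finset.sum_add_distrib, hE1, hE3, hE2]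
  ring


end Summit.HodgeConjecture.HodgeConjecture.Theorems.FormalCycleCriterion

end
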